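import Summits.QuantumAdvantage.QuantumAdvantage.Theorems.NearExactIsExact.Negative.BqqSeven
import Summits.QuantumAdvantage.QuantumAdvantage.Theorems.NearExactIsExact.Negative.FifteenSixteenths

/-!
# `NearExactIsExact` (stmt-QuantumAdvantage-14043) — negative lemma THEOREM A, part 1: the parity core

Abstract half of the gen-17 THEOREM A of the b2b cell (see `Negative.SkewProductResidual` for the
statement about skew-product biquadratic permutations and the context). Everything lives on `𝔽₂⁶`
(the quotient by the flat direction): a bijection `γ`, quadratic `ρ_k` with `ρ_k ∘ γ` quadratic
(`k < r`), and a coefficient family `C_S` (`S ⊆ [r]`, `deg C_S ≤ 3 − |S|`). With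
`ĉ(v) = Σ_{|S| ≤ 3} ρ_S(v) C_S(v)` (`texp`) and the `t_k`-coefficients `ĉ_k` (`tcoef`, a discrete
derivative by `tcoef_eq`), the formal Euler identity `ĉ + Σ_k ρ_k ĉ_k = Σ_{|S| even} ρ_S C_S` (`euler`;
on a monomial `w_S` both sides are `(1+|S|) w_S`) has right-hand side of degree `≤ 5 < 6`, hence even
weight by Ax/McEliece (`stub_axParity` at `n = 6`, `d = 5`); if moreover every `ĉ_k ∘ γ` is quadratic
then each `ρ_k ĉ_k` has even weight (its `γ`-pullback has degree `≤ 4`), so `ĉ` has even weight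
(`core`). Supporting folklore: `𝔽₂`-indicators `ind`, degree of `𝔽₂`-sums/products of bounded-degree
functions, Möbius inversion on the cube in characteristic `2` (`sum_powerset_sum_powerset`).

HONEST FRAMING: the value here is a THEOREM (kernel-checked negative-side lemma), NOT summit progress.
-/

set_option linter.dupNamespace false -- D-0017: single-problem summit ⇒ `QuantumAdvantage.QuantumAdvantage` by design

namespace Summit.QuantumAdvantage.QuantumAdvantage.Theorems.NearExactIsExact.Negative.SkewProductCore

open Finset
open Literature.Computability.QuantumComplexity
open Literature.Computability.QuantumComplexity.BuzetChailloux (bxor)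
open Summit.QuantumAdvantage.QuantumAdvantage.Theorems.CubicForrelation.NearExactIsExact
  (stub_axParity fc_sum_signOf_eq_card fc_deg_bxor te_isDegLeFun_band)
open Summit.QuantumAdvantage.QuantumAdvantage.Theorems.NearExactIsExact.Negative.BqqSeven
  (bq_card_filter_comp natCast_eq_zero_of_even)

/-! ### `𝔽₂`-valued indicators, small Boolean facts -/

/-- The `𝔽₂`-value of a Boolean. [folklore] -/
def ind (x : Bool) : ZMod 2 := if x then 1 else 0

/-- `ind true = 1`. [folklore] -/
@[simp] theorem ind_true : ind true = 1 := rfl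

/-- `ind false = 0`. [folklore] -/
@[simp] theorem ind_false : ind false = 0 := rfl

/-- `ind` is additive for `⊕`. [folklore] -/
theorem ind_xor (x y : Bool) : ind (x ^^ y) = ind x + ind y := by
  cases x <;> cases y <;> decide

/-- `ind` is multiplicative for `∧`. [folklore] -/
theorem ind_and (x y : Bool) : ind (x && y) = ind x * ind y := by
  cases x <;> cases y <;> decide

/-- `ind (1 ⊕ x) + ind x = 1`. [folklore] -/
theorem ind_true_xor_add (x : Bool) : ind (true ^^ x) + ind x = 1 := by
  cases x <;> decide

/-- Reading an `𝔽₂`-indicator back as a Boolean. [folklore] -/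
theorem decide_ind_eq_one (x : Bool) : decide (ind x = 1) = x := by
  cases x <;> decide

/-- Reading a Boolean back as an element of `𝔽₂`. [folklore] -/
theorem ind_decide_eq_one : ∀ a : ZMod 2, ind (decide (a = 1)) = a := by
  decide

/-- `(a ⊕ b = c) ⇒ b = a ⊕ c`. [folklore] -/
theorem bool_solve : ∀ a b c : Bool, (a ^^ b) = c → b = (a ^^ c) := by
  decide

/-- `(x ⊕ d) ⊕ (y ⊕ d) = y ⊕ x`. [folklore] -/
theorem bool_cancel : ∀ x y d : Bool, ((x ^^ d) ^^ (y ^^ d)) = (y ^^ x) := by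
  decide

/-! ### Weights: `Σ_x ind (F x)` and the Ax parity on `6` bits -/

/-- `Σ_x ind (F x) = wt(F)` in `𝔽₂`. [folklore] -/
theorem sum_ind {α : Type*} [Fintype α] (F : α → Bool) :
    ∑ x, ind (F x) = ((univ.filter fun x => F x = true).card : ZMod 2) := by
  unfold ind
  exact (Finset.natCast_card_filter _ _).symm

/-- Ax / McEliece at `n = 6`, `d = 5`: a Boolean function of degree `≤ 5` on `6` bits has even weight
(`Σ_x (−1)^{F(x)} = 64 − 2·wt(F) ∈ 2^{⌈6/5⌉}ℤ = 4ℤ`). [folklore] -/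
theorem even_card_of_deg_five {F : (Fin 6 → Bool) → Bool} (hF : IsDegLeFun 5 F) :
    Even ((univ.filter fun x : Fin 6 → Bool => F x = true).card) := by
  obtain ⟨z, hz⟩ := stub_axParity 6 5 F univ (by norm_num) hF
  rw [filter_true_of_mem (fun u _ i _ => mem_univ i), card_fin, fc_sum_signOf_eq_card] at hz
  have h4 : (2 : ℝ) ^ ((6 + 5 - 1) / 5) = 4 := by norm_num
  rw [h4] at hz
  have hc : (((univ.filter fun x : Fin 6 → Bool => F x = true).card : ℤ) : ℝ) =
      ((2 * (16 - z) : ℤ) : ℝ) := by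
    push_cast
    linear_combination (-(1 : ℝ) / 2) * hz
  have he : Even (((univ.filter fun x : Fin 6 → Bool => F x = true).card : ℤ)) :=
    ⟨16 - z, by rw [Int.cast_injective hc]; ring⟩
  exact (Int.even_coe_nat _).mp he

/-- Degree `≤ 5` on `6` bits ⇒ `Σ_x ind (F x) = 0`. [folklore] -/
theorem sum_ind_eq_zero_of_deg_five {F : (Fin 6 → Bool) → Bool} (hF : IsDegLeFun 5 F) :
    ∑ x, ind (F x) = 0 := by
  rw [sum_ind]
  exact natCast_eq_zero_of_even (even_card_of_deg_five hF)

/-- Through a bijection `γ`: if `F ∘ γ` has degree `≤ 5` then `Σ_v ind (F v) = 0`. [folklore] -/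
theorem sum_ind_comp_eq_zero {γ : (Fin 6 → Bool) → (Fin 6 → Bool)} (hγ : Function.Bijective γ)
    {F : (Fin 6 → Bool) → Bool} (hF : IsDegLeFun 5 (fun u => F (γ u))) : ∑ v, ind (F v) = 0 := by
  have h := sum_ind_eq_zero_of_deg_five hF
  rwa [sum_ind, bq_card_filter_comp γ hγ F, ← sum_ind] at h

/-! ### Degree bookkeeping for `𝔽₂`-sums and products -/

/-- A finite `𝔽₂`-sum of functions of degree `≤ d` has degree `≤ d`. [folklore] -/
theorem isDegLeFun_sum {n d : ℕ} {ι : Type*} [DecidableEq ι] (a : ι → (Fin n → Bool) → ZMod 2)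
    (T : Finset ι) (h : ∀ i ∈ T, IsDegLeFun d (fun x => decide (a i x = 1))) :
    IsDegLeFun d (fun x => decide ((∑ i ∈ T, a i x) = 1)) := by
  induction T using Finset.induction_on with
  | empty =>
    have e : (fun x : Fin n → Bool => decide ((∑ i ∈ (∅ : Finset ι), a i x) = 1)) = fun _ => false := by
      funext x; rw [sum_empty]; decide
    rw [e]
    exact isDegLeFun_const d false
  | insert i T hi ih =>
    have e : (fun x => decide ((∑ j ∈ insert i T, a j x) = 1)) =
        fun x => (decide (a i x = 1) ^^ decide ((∑ j ∈ T, a j x) = 1)) := by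
      funext x; rw [sum_insert hi, zmod2_decide_add]
    rw [e]
    exact fc_deg_bxor (h i (mem_insert_self i T)) (ih fun j hj => h j (mem_insert_of_mem hj))

/-- A product of `|S|` functions of degree `≤ d` has degree `≤ d·|S|`. [folklore] -/
theorem isDegLeFun_prod {n d : ℕ} {ι : Type*} [DecidableEq ι] (a : ι → (Fin n → Bool) → Bool)
    (S : Finset ι) (h : ∀ i ∈ S, IsDegLeFun d (a i)) :
    IsDegLeFun (d * S.card) (fun x => decide ((∏ i ∈ S, ind (a i x)) = 1)) := by
  induction S using Finset.induction_on with
  | empty =>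
    have e : (fun x : Fin n → Bool => decide ((∏ i ∈ (∅ : Finset ι), ind (a i x)) = 1)) = fun _ => true := by
      funext x; rw [prod_empty]; decide
    rw [e]
    exact isDegLeFun_const _ true
  | insert i S hi ih =>
    have e : (fun x => decide ((∏ j ∈ insert i S, ind (a j x)) = 1)) =
        fun x => (a i x && decide ((∏ j ∈ S, ind (a j x)) = 1)) := by
      funext x; rw [prod_insert hi, zmod2_decide_mul, decide_ind_eq_one]
    rw [e, card_insert_of_notMem hi, Nat.mul_succ, add_comm]
    exact te_isDegLeFun_band (h i (mem_insert_self i S)) (ih fun j hj => h j (mem_insert_of_mem hj))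

/-! ### Möbius inversion on the cube, in characteristic `2` -/

/-- `Σ_{S ⊆ T} Σ_{J ⊆ S} a(J) = a(T)` over `𝔽₂` (each `J ⊊ T` is counted `2^{|T∖J|}` times). [folklore] -/
theorem sum_powerset_sum_powerset {ι : Type*} [DecidableEq ι] (a : Finset ι → ZMod 2) (T : Finset ι) :
    ∑ S ∈ T.powerset, ∑ J ∈ S.powerset, a J = a T := by
  induction T using Finset.induction_on generalizing a with
  | empty => simp
  | insert i T hi ih =>
    rw [sum_powerset_insert hi]
    have h2 : ∀ S ∈ T.powerset, ∑ J ∈ (insert i S).powerset, a J =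
        ∑ J ∈ S.powerset, a J + ∑ J ∈ S.powerset, a (insert i J) := fun S hS =>
      sum_powerset_insert (fun h => hi (mem_powerset.mp hS h)) a
    rw [sum_congr rfl h2, sum_add_distrib, ← add_assoc, ih a, ih (fun J => a (insert i J)),
      CharTwo.add_self_eq_zero, zero_add]

variable {r : ℕ}

/-- The indicator vector of `J ⊆ [r]`. [folklore] -/
def indic (J : Finset (Fin r)) : Fin r → Bool := fun j => decide (j ∈ J)

/-- The support of a vector. [folklore] -/
def supp (w : Fin r → Bool) : Finset (Fin r) := univ.filter fun j => w j = true

/-- `indic (supp w) = w`. [folklore] -/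
theorem indic_supp (w : Fin r → Bool) : indic (supp w) = w := by
  funext j; simp [indic, supp]

/-- `Π_{k ∈ S} w_k = [S ⊆ supp w]`. [folklore] -/
theorem prod_ind_eq (w : Fin r → Bool) (S : Finset (Fin r)) :
    (∏ k ∈ S, ind (w k)) = if S ⊆ supp w then 1 else 0 := by
  by_cases h : S ⊆ supp w
  · rw [if_pos h]
    refine prod_eq_one fun k hk => ?_
    have hw : w k = true := by simpa [supp] using h hk
    rw [hw, ind_true]
  · rw [if_neg h]
    obtain ⟨k, hkS, hk⟩ := not_subset.mp h
    refine prod_eq_zero hkS ?_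
    have hw : w k = false := by simpa [supp] using hk
    rw [hw, ind_false]

/-- `Σ_{S ⊆ supp w} A(S) = Σ_S w_S · A(S)`. [folklore] -/
theorem sum_powerset_supp (w : Fin r → Bool) (A : Finset (Fin r) → ZMod 2) :
    ∑ S ∈ (supp w).powerset, A S = ∑ S, (∏ k ∈ S, ind (w k)) * A S := by
  simp_rw [prod_ind_eq, boole_mul]
  rw [← sum_filter]
  congr 1
  ext S
  simp [mem_powerset]

/-! ### The abstract parity core (`ĉ`, `ĉ_k`, Euler identity) -/

/-- The index sets `S ⊆ [r]` with `|S| ≤ 3`. [folklore] -/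
def P3 (r : ℕ) : Finset (Finset (Fin r)) := univ.filter fun S => S.card ≤ 3

/-- Membership in `P3`. [folklore] -/
@[simp] theorem mem_P3 {S : Finset (Fin r)} : S ∈ P3 r ↔ S.card ≤ 3 := by
  simp [P3]

/-- `texp C w v = Σ_{|S| ≤ 3} w_S · C_S(v)`: the cubic-in-`w` expansion with coefficient family `C`
(for `C = coefC c₂` this is `c₂(v,w)`, see `expand`). [folklore] -/
def texp (C : Finset (Fin r) → (Fin 6 → Bool) → Bool) (w : Fin r → Bool) (v : Fin 6 → Bool) : ZMod 2 :=
  ∑ S ∈ P3 r, (∏ j ∈ S, ind (w j)) * ind (C S v)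

/-- `tcoef ρ C k v = Σ_{|S| ≤ 3, k ∈ S} ρ_{S∖k}(v) · C_S(v)`: the `t_k`-coefficient of
`t ↦ Σ_S (t ⊕ ρ v)_S C_S(v)` (equivalently `ĉ_k`, see `tcoef_eq`). [folklore] -/
def tcoef (ρ : Fin r → (Fin 6 → Bool) → Bool) (C : Finset (Fin r) → (Fin 6 → Bool) → Bool) (k : Fin r)
    (v : Fin 6 → Bool) : ZMod 2 :=
  ∑ S ∈ (P3 r).filter (fun S => k ∈ S), (∏ j ∈ S.erase k, ind (ρ j v)) * ind (C S v)

/-- `ĉ_k` is a discrete derivative: `tcoef ρ C k v = texp C (ρ v ⊕ e_k) v + texp C (ρ v) v`. [folklore] -/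
theorem tcoef_eq (ρ : Fin r → (Fin 6 → Bool) → Bool) (C : Finset (Fin r) → (Fin 6 → Bool) → Bool)
    (k : Fin r) (v : Fin 6 → Bool) :
    tcoef ρ C k v = texp C (fun j => decide (j = k) ^^ ρ j v) v + texp C (fun j => ρ j v) v := by
  simp only [tcoef, texp]
  rw [← sum_add_distrib, sum_filter]
  refine sum_congr rfl fun S _ => ?_
  rw [← add_mul]
  by_cases hkS : k ∈ S
  · have e1 : ind (decide (k = k) ^^ ρ k v) * ∏ j ∈ S.erase k, ind (decide (j = k) ^^ ρ j v) =
        ∏ j ∈ S, ind (decide (j = k) ^^ ρ j v) :=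
      mul_prod_erase S (fun j => ind (decide (j = k) ^^ ρ j v)) hkS
    have e2 : ind (ρ k v) * ∏ j ∈ S.erase k, ind (ρ j v) = ∏ j ∈ S, ind (ρ j v) :=
      mul_prod_erase S (fun j => ind (ρ j v)) hkS
    have e3 : ∏ j ∈ S.erase k, ind (decide (j = k) ^^ ρ j v) = ∏ j ∈ S.erase k, ind (ρ j v) :=
      prod_congr rfl fun j hj => by rw [decide_eq_false (ne_of_mem_erase hj), Bool.false_xor]
    rw [if_pos hkS, ← e1, ← e2, e3, ← add_mul, decide_eq_true (Eq.refl k), ind_true_xor_add, one_mul]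
  · have e3 : ∏ j ∈ S, ind (decide (j = k) ^^ ρ j v) = ∏ j ∈ S, ind (ρ j v) :=
      prod_congr rfl fun j hj => by
        rw [decide_eq_false (fun h : j = k => hkS (h ▸ hj)), Bool.false_xor]
    rw [if_neg hkS, e3, CharTwo.add_self_eq_zero, zero_mul]

/-- The formal Euler identity `ĉ + Σ_k ρ_k ĉ_k = Σ_{|S| even} ρ_S C_S` (on a monomial `w_S` both
sides are `(1 + |S|)·w_S`). [folklore] -/
theorem euler (ρ : Fin r → (Fin 6 → Bool) → Bool) (C : Finset (Fin r) → (Fin 6 → Bool) → Bool)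
    (v : Fin 6 → Bool) :
    texp C (fun j => ρ j v) v + ∑ k, ind (ρ k v) * tcoef ρ C k v =
      ∑ S ∈ (P3 r).filter (fun S => Even S.card), (∏ j ∈ S, ind (ρ j v)) * ind (C S v) := by
  have ha : ∀ k, ind (ρ k v) * tcoef ρ C k v =
      ∑ S ∈ P3 r, if k ∈ S then (∏ j ∈ S, ind (ρ j v)) * ind (C S v) else 0 := by
    intro k
    simp only [tcoef]
    rw [sum_filter, mul_sum]
    refine sum_congr rfl fun S _ => ?_
    split_ifs with hkS
    · have e : ind (ρ k v) * ∏ j ∈ S.erase k, ind (ρ j v) = ∏ j ∈ S, ind (ρ j v) :=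
        mul_prod_erase S (fun j => ind (ρ j v)) hkS
      rw [← mul_assoc, e]
    · exact mul_zero _
  have hb : ∑ k, ind (ρ k v) * tcoef ρ C k v =
      ∑ S ∈ P3 r, (S.card : ZMod 2) * ((∏ j ∈ S, ind (ρ j v)) * ind (C S v)) := by
    rw [sum_congr rfl (fun k _ => ha k), sum_comm]
    refine sum_congr rfl fun S _ => ?_
    rw [sum_ite_mem, univ_inter, sum_const, nsmul_eq_mul]
  rw [hb]
  simp only [texp]
  rw [← sum_add_distrib, sum_filter]
  refine sum_congr rfl fun S _ => ?_
  rcases Nat.even_or_odd S.card with he | ho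
  · rw [if_pos he, (ZMod.natCast_eq_zero_iff_even).mpr he, zero_mul, add_zero]
  · rw [if_neg (Nat.not_even_iff_odd.mpr ho), (ZMod.natCast_eq_one_iff_odd).mpr ho, one_mul,
      CharTwo.add_self_eq_zero]

/-- **THEOREM A, abstract core.** `γ` a bijection of `𝔽₂⁶`; `ρ_k`, `ρ_k ∘ γ` quadratic; a coefficient
family `C_S` of degree `≤ 3 − |S|`; and every `ĉ_k ∘ γ` quadratic. Then `ĉ = texp C ρ` has even
weight: `Σ_v ĉ(v) = 0` in `𝔽₂`. [folklore] -/
theorem core {γ : (Fin 6 → Bool) → (Fin 6 → Bool)} (hγ : Function.Bijective γ)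
    {ρ : Fin r → (Fin 6 → Bool) → Bool} (hρ : ∀ k, IsDegLeFun 2 (ρ k))
    (hργ : ∀ k, IsDegLeFun 2 (fun u => ρ k (γ u)))
    {C : Finset (Fin r) → (Fin 6 → Bool) → Bool} (hC : ∀ S, IsDegLeFun (3 - S.card) (C S))
    (hk : ∀ k, IsDegLeFun 2 (fun u => decide (tcoef ρ C k (γ u) = 1))) :
    ∑ v, texp C (fun j => ρ j v) v = 0 := by
  -- the right-hand side of the Euler identity has degree `≤ 5`, hence even weight
  have hG : IsDegLeFun 5 (fun v => decide ((∑ S ∈ (P3 r).filter (fun S => Even S.card),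
      (∏ j ∈ S, ind (ρ j v)) * ind (C S v)) = 1)) := by
    refine isDegLeFun_sum (fun S v => (∏ j ∈ S, ind (ρ j v)) * ind (C S v)) _ (fun S hS => ?_)
    rw [mem_filter, mem_P3] at hS
    obtain ⟨h3, m, hm⟩ := hS
    have e : (fun v => decide ((∏ j ∈ S, ind (ρ j v)) * ind (C S v) = 1)) =
        fun v => (decide ((∏ j ∈ S, ind (ρ j v)) = 1) && C S v) := by
      funext v; rw [zmod2_decide_mul, decide_ind_eq_one]
    rw [e]
    exact (te_isDegLeFun_band (isDegLeFun_prod (fun j => ρ j) S (fun j _ => hρ j)) (hC S)).mono (by omega)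
  have hsumG : ∑ v, (∑ S ∈ (P3 r).filter (fun S => Even S.card),
      (∏ j ∈ S, ind (ρ j v)) * ind (C S v)) = 0 := by
    have h0 := sum_ind_eq_zero_of_deg_five hG
    simpa only [ind_decide_eq_one] using h0
  -- each `ρ_k ĉ_k` has even weight, through the bijection `γ`
  have hsumK : ∀ k, ∑ v, ind (ρ k v) * tcoef ρ C k v = 0 := by
    intro k
    have hdeg : IsDegLeFun 5 (fun u => ρ k (γ u) && decide (tcoef ρ C k (γ u) = 1)) :=
      (te_isDegLeFun_band (hργ k) (hk k)).mono (by norm_num)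
    have h0 := sum_ind_comp_eq_zero hγ (F := fun v => ρ k v && decide (tcoef ρ C k v = 1)) hdeg
    simpa only [ind_and, ind_decide_eq_one] using h0
  have htot : ∑ v, (texp C (fun j => ρ j v) v + ∑ k, ind (ρ k v) * tcoef ρ C k v) = 0 := by
    rw [sum_congr rfl (fun v _ => euler ρ C v)]
    exact hsumG
  rw [sum_add_distrib, sum_comm, sum_congr rfl (fun k _ => hsumK k), sum_const_zero, add_zero] at htot
  exact htot

end Summit.QuantumAdvantage.QuantumAdvantage.Theorems.NearExactIsExact.Negative.SkewProductCore
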